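import Summits.Ventures.HSemireg.Pad4TowerPsiSubA1
import Summits.Ventures.HSemireg.Pad4TowerFCCoreSeam
import Summits.HodgeConjecture.HodgeConjecture.Cruxes.BlochSeedDiscOne.Anchor

/-!
# BlochSeedDiscOne — negation lens g4, LINE 4 (crux idea `uv-swap-companion-law`): the u↔v SWAP LAW of the class screen,
# the COMPANION LAW of the unbalanced limb (F3), and the CLASS-LEVEL INERTNESS of imbalance (off-shell balanced shadow)

HONEST FRAMING. Ideator sketch (planner `plan-lens-HodgeAV-negation` g4, LENSES-v3 lens «negation», director-hodge req-36) for the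
crux `Summit.HodgeConjecture.HodgeConjecture.Theses.EightfoldBlochSeeds.BlochSeedDiscOne` (item stmt-HodgeConjecture-18881; verbatim
`:= Literature.AlgebraicGeometry.HodgeTheory.HasHyperbolicBlochSeed 4 1`; skeleton `Lines/birth.lean` 814a6a70c14e831a, STUB R =
`stub_rung_pad4_seedAt`). NOTHING HERE PROVES HC, HC_CM, HC_AV, H2 or stmt-18881; HC_CM is a displayed binder of the ladder only; no
variety, no sheaf, no σ, no seed is constructed; every statement below is a theorem of the CLASS FRAME OF RECORD (`Pad4TowerClassScreen`:
`6⁴` words, letters `(1, u, v, e, ē, p)`, the class screen (A1) `ClassScreen`) and of nothing else. Width toward H2 = 0 (necessary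
conditions and exact class-level reductions only). 0 `sorry`, no `axiom`, no `instance`, no notation.

THE NEGATION MOVE OF THIS LINE. Assume STUB R's seed exists with an ⊕-block design in the frame of record. The frame's letter of a block
`[[α, β], [β̄, α′]]` on `S_f = E × E` is `(1, α, α′, β, β̄, αα′ − |β|²)` (pad4lib `phi`); the ENTIRE census of record (bc5-plan card v4.24 rows
W1–W23: ◇₈ FAMCORE j305149, ◇₁₀ j308425 ∕ j318002, G′ j310053, THIRDCODE j313137 ∕ j317021, A9 j317448) and every typed static family
(`Pad4Tower*`: `BPoint = (α, Re β, Im β)`, `bphi`) live on the BALANCED slice `α = α′` (𝔅(μ₄)); the unbalanced limb (F3) of the AD-4 anchor's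
live search space (card v4.24 l.17, l.48: «Λ²V_f lever `(α′_f − α_f)k_ff`, (r2b) planes; non-cancellation fails there» — one line, no screen)
is where a synthesist escaping the census goes next. This file types what (A1) FORCES there.

CONTENT (all PROVED).
* §1 `lswap`, `swapAt f` (exchange the letters `u ↔ v` on factor `f`), their screen facts, and **THE SWAP LAW `swap_law`: every class
  function passing the class screen is invariant under `u ↔ v` on each factor separately** (alphabet-free, all weights, any `Zero R`).
  On balanced designs this is vacuous (each cell's tensor is swap-invariant); it is the FIRST class-level law that sees imbalance.
* §2 general (possibly unbalanced) designs: letter vectors `v j f : Fin 6 → R` per cell `j` and factor `f`, signed weights `c j`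
  (`= ± multiplicity`), `dTensor s c v = Σ_j c_j ⊗_f v_{j,f}`; `rest3` (the product of the three letters off `f`); **THE COMPANION LAW
  `imbalance_moment_eq_zero`: `Σ_j c_j · (v_{j,f}(u) − v_{j,f}(v)) · Π_{g ≠ f} v_{j,g}(x_g) = 0` for every factor `f` and every probe word `x`**
  (the imbalance `δ_{j,f} = α − α′` weighted by ANY letters on the other three factors — `x = 111`: total signed imbalance `Σ_N mδ = Σ_P mδ`;
  `x = eee`: the CHARGED imbalance moment `Σ ± m δ_f Π_{g≠f} β_g = 0`, invisible to e-free functionals); corollaries with normalised letters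
  (`v_{j,g}(1) = 1`): `total_imbalance_eq_zero`, **`no_lone_unbalanced_cell`** (a design with exactly one cell unbalanced on `f` fails (A1)),
  **`companion_pair`** (exactly two cells unbalanced on `f` ⇒ their weighted imbalances cancel AND `c₁δ₁ · (v_{j₁,g} − v_{j₂,g}) = 0` for all
  `g ≠ f`: in a domain they AGREE OFF `f` — an `f`-local twin (same level, opposite `δ`) or an `f`-local partner pair (opposite levels, equal `mδ`)),
  `mixed_moment_eq_zero` (second mixed moments `Σ c δ_f δ_g ⊗ rest = 0`); block forms `total_delta_eq_zero` (`Σ c (α − α′) = 0`) and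
  `charged_delta_eq_zero_factor0` (`Σ c (α₀ − α′₀) β₁β₂β₃ = 0`).
* §3 Ψ-rows on general blocks (`gphi α α′ β β̄ = (1, α, α′, β, β̄, αα′ − ββ̄)`; `bphi_eq_gphi`: the tree's 𝔅(μ₄) letter `bphi` IS the diagonal
  `gphi α α β β̄` over `ℤ[i]`, so `MConfig.wch` is a `dTensor` of balanced letters): `lamTwelve_chTensor_gphi` — Λ reads only `1, u, p`, so
  `Λ₁₂(⊗ gphi) = 12Ψ(α; s^u)` with `s^u_f = β_f β̄_f + α_f(α_f − α′_f)` (u-reading) and `= 12Ψ(α′; s^v)`, `s^v_f = β_f β̄_f − α′_f(α_f − α′_f)`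
  (v-reading, through the swapped functional); **`psiRow_u_of_classScreen` ∕ `psiRow_v_of_classScreen`**: both rows vanish on (A1) designs;
  **`dTensor_symAll_eq` + `psiRow_phantom_of_classScreen`** (over a field with `2 ≠ 0`): under (A1) the design tensor EQUALS the tensor of the
  factorwise-symmetrised letters `(1, α̃, α̃, β, β̄, αα′ − ββ̄)`, `α̃ = (α + α′)∕2` — a BALANCED letter vector OFF SHELL by the PHANTOM CHARGE
  `δ²∕4 ≥ 0` (`α̃² − p = ββ̄ + δ²∕4`) — so the Ψ-row of an (F3) design is the balanced Ψ-row with `s_f ↦ |β_f|² + δ_f²∕4`.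
* §4 CLASS-LEVEL INERTNESS, constructive: `gphi_eq_phiVec_off_v` (the u-reading of an unbalanced letter is the tree's `phiVec α β β̄ p` with
  `p` off shell by `−αδ`), `two_mul_gphi_u_exchange` (off `v`, `2·gphi(α,α′,β) = (2+2αδ)φ(α,β) − αδ φ(α+1,β) − αδ φ(α−1,β)`: twice an
  unbalanced letter READS as an integer combination of three balanced tower letters; `eight_mul_gphi_u_exchange_fwd`: the forward step-2
  form `8·gphi = (8−αδ)φ(α) + 2αδ φ(α+2) − αδ φ(α+4)`, which keeps `β`, node-level parity and the light cone: `◇_h ↦ ◇_{h+4}`), `tower_second_difference` (`φ(a+1) − 2φ(a) + φ(a−1) = 2·e_p` for on-shell balanced letters stacked in `α`: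
  p-shifts are generated by balanced towers), **`twin_pair_exchange`**: an unbalanced twin pair `{(a+d, a−d, β), (a−d, a+d, β)}` on a factor
  is, AS A CLASS, `2·(a, β)` balanced minus `d²` times a balanced tower second difference (ANY base letter) — lifted to cells by
  `chTensor_update_linear`. Hence (A1) ∧ μ ≠ 0 is solvable with unbalanced cells iff it is solvable with balanced cells (over ℚ): imbalance
  buys NOTHING at class level; any advantage of (F3) is FIRST-ORDER (the Λ²V_f lever), which no typed static family reaches.
* §5 `VFree`, `ClassScreenU` (the screen on v-free words) and **`classScreen_iff_swap_and_uScreen`**: (A1) on general blocks ⟺ the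
  balanced-frame screen of the u-reading ∧ the swap rows — the encodable form of an (F3) cell: balanced letters `(α_f, β_f)` + one
  integer `δ_f` per letter (p-entry `α_f(α_f − δ_f) − |β_f|²`) + the companion rows of §2.
* §6 numeric certificates (`decide` ∕ `norm_num`).
* §7 (rev 2, after critic L4⁽ⁿᵉᵍ⁾ N4-1's rider «which then needs its own typed statement» and director R17.33's dichotomy U4-3;
  branch-neutral) **E-FRAME TRANSFER**: a word with letters in `{1, e, ē}` reads only the entries `0, 3, 4` of the letter vectors, where
  `gphi α α′ β β̄` agrees with its u-reading `gphi α α β β̄` and its v-reading `gphi α′ α′ β β̄`; so every E-frame row of an (F3) design —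
  `μ`, `μ̄` (`mu_eq_uReading`) and the fourteen FC-CORE sign-word rows `T (sWord s)`, `s ≠ 0, 15` (`eFrame_row_eq_uReading`,
  **`uReading_sWord_rows_vanish`** ∕ `vReading_sWord_rows_vanish`) — EQUALS the same row of both balanced readings: FC-CORE's (A1)-input
  transfers to the u-reading design with NO exchange and NO height shift (FC-CORE consumes (A1) only through those rows,
  `Pad4TowerFCCoreParitySeam.rows_of_classScreen_axis`), although the u-reading design need not pass (A1) itself (its `u`∕`p` rows differ).
  This is the typed support-level half of U4-3's branch (i); the class-function half is §4 (shift `◇_h ↦ ◇_{h+4}`).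

PRIOR ART INSIDE THE CELL (searched; cited in the card): gs-eng-2 g47 l.29802 (3) + s4-ref-2 g4 OBJECTION O1 l.29816 (conceded l.29819):
«the S₄-symmetric weight-4 t-free ℚ[h]-killing functionals on UNBALANCED blocks form a 3-dimensional space» with integer basis
`{11pp − 2·1puv + uuvv}, {2·11pp − 1puu − 2·1puv − 1pvv + uuuv + uvvv}, {2·11pp − 4·1puu + 4·1puv − 4·1pvv + uuuu + vvvv}` (third ↦ 2Ψ on
balanced blocks; placement-AVERAGED word types, the normalisation under which «kills ℚ[h]» reads `Σ λ = 0` — cf. `h^k = k!·Σ_{wdeg = k} w`).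
READING OF THAT COUNT through §1 (pencil, on the printed basis; not a kernel statement): all three vectors are u↔v-SYMMETRIC, as the swap
law demands; with the six averaged weight-4 swap rows `r₁ = 1puu − 1puv, r₂ = 1pvv − 1puv, r₃ = uuuu − uuuv, r₄ = uuuv − uuvv, r₅ = uuvv − uvvv,
r₆ = uvvv − vvvv` one has `B₂ − 2B₁ = −r₁ − r₂ + r₄ − r₅` and `B₃ − 2B₁ = −4r₁ − 4r₂ + r₃ + r₄ − r₅ − r₆`, while `B₁ ≡ Λ₁₂∕12 = 11pp − 2·1puu + uuuu`
(mod swap rows) — so the space is `ℚ·[Λ] ⊕ (2-dim ∩ swap-row span)`: `3 = 1 + 2`. The t-free representative of `[Λ]` is NOT the u-reading Ψ-row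
(its `s^u_f = |β_f|² + α_f δ_f` carries the pad shift) but the PHANTOM Ψ-row of §3 (`α̃_f − α̃_g` and `|β|² + δ²∕4` are shift-free). The swap
sector of THIS file is the complete u↔v-antisymmetric content of (A1) at ALL weights and e-patterns (§5), incl. the charged moments
(`Σ c δ₀ β₁β₂β₃ = 0`) that no e-free functional sees.
-/

set_option linter.dupNamespace false

namespace Summit.HodgeConjecture.HodgeConjecture.Cruxes.BlochSeedDiscOne.UvSwapCompanionLaw

open Finset Summit.Ventures.HSemireg.Pad4Tower

/-! ## §1 The swap `u ↔ v` on one factor and THE SWAP LAW -/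

/-- exchange the letters `u` (`1`) and `v` (`2`); fix `1, e, ē, p`. -/
def lswap : Fin 6 → Fin 6 := ![0, 2, 1, 3, 4, 5]

/-- `lswap` is an involution. [`decide`] -/
theorem lswap_lswap : ∀ l : Fin 6, lswap (lswap l) = l := by decide

/-- `lswap` preserves letter degrees. [`decide`] -/
theorem ldeg_lswap : ∀ l : Fin 6, ldeg (lswap l) = ldeg l := by decide

/-- `lswap l = e ↔ l = e`. [`decide`] -/
theorem lswap_eq_three_iff : ∀ l : Fin 6, lswap l = 3 ↔ l = 3 := by decide

/-- `lswap l = ē ↔ l = ē`. [`decide`] -/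
theorem lswap_eq_four_iff : ∀ l : Fin 6, lswap l = 4 ↔ l = 4 := by decide

/-- `lswap` preserves «neither `e` nor `ē`». [`decide`] -/
theorem lswap_ne34_iff : ∀ l : Fin 6, (lswap l ≠ 3 ∧ lswap l ≠ 4) ↔ (l ≠ 3 ∧ l ≠ 4) := by decide

/-- `lswap u = v`, `lswap v = u`. [`decide`] -/
theorem lswap_one_two : lswap 1 = 2 ∧ lswap 2 = 1 := by decide

/-- swap `u ↔ v` on factor `f` of a word, leaving the other three letters alone. -/
def swapAt (f : Fin 4) (w : CWord) : CWord := fun g => if g = f then lswap (w g) else w g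

theorem swapAt_same (f : Fin 4) (w : CWord) : swapAt f w f = lswap (w f) := by simp [swapAt]

theorem swapAt_of_ne {f g : Fin 4} (w : CWord) (h : g ≠ f) : swapAt f w g = w g := by simp [swapAt, h]

/-- `swapAt f` is an involution. -/
theorem swapAt_swapAt (f : Fin 4) (w : CWord) : swapAt f (swapAt f w) = w := by
  funext g
  by_cases h : g = f
  · simp only [swapAt, if_pos h, lswap_lswap]
  · simp only [swapAt, if_neg h]

/-- `swapAt f` preserves e-freeness. -/
theorem eFree_swapAt_iff (f : Fin 4) (w : CWord) : EFree (swapAt f w) ↔ EFree w := by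
  refine forall_congr' fun g => ?_
  by_cases h : g = f
  · simp only [swapAt, if_pos h]
    exact lswap_ne34_iff _
  · simp only [swapAt, if_neg h]

/-- `swapAt f` preserves the degree. -/
theorem wdeg_swapAt (f : Fin 4) (w : CWord) : wdeg (swapAt f w) = wdeg w := by
  fin_cases f <;> simp [wdeg, swapAt, ldeg_lswap]

/-- `swapAt f w = eeee ↔ w = eeee` (the μ-word has no `u`∕`v` letter). -/
theorem swapAt_eq_eWord_iff (f : Fin 4) (w : CWord) : swapAt f w = eWord ↔ w = eWord := by
  have e3 : ∀ g : Fin 4, eWord g = 3 := by decide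
  simp only [funext_iff, e3]
  refine forall_congr' fun g => ?_
  by_cases h : g = f
  · simp only [swapAt, if_pos h]
    exact lswap_eq_three_iff _
  · simp only [swapAt, if_neg h]

/-- `swapAt f w = ēēēē ↔ w = ēēēē`. -/
theorem swapAt_eq_ebarWord_iff (f : Fin 4) (w : CWord) : swapAt f w = ebarWord ↔ w = ebarWord := by
  have e4 : ∀ g : Fin 4, ebarWord g = 4 := by decide
  simp only [funext_iff, e4]
  refine forall_congr' fun g => ?_
  by_cases h : g = f
  · simp only [swapAt, if_pos h]
    exact lswap_eq_four_iff _
  · simp only [swapAt, if_neg h]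

/-- **THE SWAP LAW.** A class function passing the class screen (A1) is invariant under `u ↔ v` on every factor separately:
an e-free word and its swap are e-free of equal degree (clause (ii)); an e-containing word other than `eeee`, `ēēēē` and its swap
both vanish (clause (i)); `eeee`, `ēēēē` are fixed. Alphabet-free, all weights; over any type with `0`. -/
theorem swap_law {R : Type*} [Zero R] (T : CWord → R) (hT : ClassScreen T) (f : Fin 4) (w : CWord) :
    T (swapAt f w) = T w := by
  obtain ⟨h0, hd⟩ := hT
  by_cases hw : EFree w
  · exact hd _ _ ((eFree_swapAt_iff f w).2 hw) hw (wdeg_swapAt f w)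
  · by_cases he : w = eWord
    · rw [he, (swapAt_eq_eWord_iff f eWord).2 rfl]
    · by_cases hb : w = ebarWord
      · rw [hb, (swapAt_eq_ebarWord_iff f ebarWord).2 rfl]
      · rw [h0 w hw he hb, h0 (swapAt f w) (fun h => hw ((eFree_swapAt_iff f w).1 h))
          (fun h => he ((swapAt_eq_eWord_iff f w).1 h)) (fun h => hb ((swapAt_eq_ebarWord_iff f w).1 h))]

/-! ## §2 General (possibly unbalanced) designs: the COMPANION LAW and its corollaries -/

section Companion

variable {R : Type*} [CommRing R] {ι : Type*}

/-- the signed class tensor of a general design: cells `j ∈ s`, signed weight `c j` (`+m` at level `N`, `−m` at level `P`),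
letter vector `v j f : Fin 6 → R` on factor `f` (ANY vectors — balanced, unbalanced, off-shell). -/
def dTensor (s : Finset ι) (c : ι → R) (v : ι → Fin 4 → Fin 6 → R) : CWord → R :=
  fun w => ∑ j ∈ s, c j * chTensor (v j) w

/-- the product of the three letters of `u` OFF factor `f`, read at the probe word `x` (the `f`-th vector replaced by `1`). -/
def rest3 (u : Fin 4 → Fin 6 → R) (f : Fin 4) (x : CWord) : R := chTensor (Function.update u f fun _ => 1) x

/-- `rest3` does not read the `f`-th letter of the probe. -/
theorem rest3_update (u : Fin 4 → Fin 6 → R) (f : Fin 4) (x : CWord) (l : Fin 6) :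
    rest3 u f (Function.update x f l) = rest3 u f x := by
  fin_cases f <;> simp [rest3, chTensor]

/-- the class tensor factorises through the `f`-th letter. -/
theorem chTensor_eq_mul_rest3 (u : Fin 4 → Fin 6 → R) (f : Fin 4) (x : CWord) :
    chTensor u x = u f (x f) * rest3 u f x := by
  fin_cases f <;> simp [rest3, chTensor] <;> ring

/-- replacing the `f`-th letter VECTOR: `⊗(u with a at f)(x) = a(x_f) · rest3`. -/
theorem chTensor_update (u : Fin 4 → Fin 6 → R) (f : Fin 4) (a : Fin 6 → R) (x : CWord) :
    chTensor (Function.update u f a) x = a (x f) * rest3 u f x := by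
  fin_cases f <;> simp [rest3, chTensor] <;> ring

/-- the class tensor is LINEAR in each letter slot (used to lift letter identities to cells, §4). -/
theorem chTensor_update_linear (u : Fin 4 → Fin 6 → R) (f : Fin 4) (a b : Fin 6 → R) (r t : R) (x : CWord) :
    chTensor (Function.update u f (r • a + t • b)) x
      = r * chTensor (Function.update u f a) x + t * chTensor (Function.update u f b) x := by
  simp only [chTensor_update, Pi.add_apply, Pi.smul_apply, smul_eq_mul]
  ring

/-- `swapAt f` turns the probe `x[f ↦ u]` into `x[f ↦ v]`. -/
theorem swapAt_update_one (f : Fin 4) (x : CWord) :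
    swapAt f (Function.update x f 1) = Function.update x f 2 := by
  funext g
  by_cases h : g = f
  · subst h
    simp [swapAt, lswap]
  · simp [swapAt, h]

/-- the IMBALANCE MOMENT of factor `f` at the probe `x`, in closed form: `T(x[f↦u]) − T(x[f↦v]) = Σ_j c_j (v_{j,f}(u) − v_{j,f}(v)) · rest3`. -/
theorem dTensor_update_one_sub_two (s : Finset ι) (c : ι → R) (v : ι → Fin 4 → Fin 6 → R) (f : Fin 4) (x : CWord) :
    dTensor s c v (Function.update x f 1) - dTensor s c v (Function.update x f 2)
      = ∑ j ∈ s, c j * (v j f 1 - v j f 2) * rest3 (v j) f x := by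
  simp only [dTensor, ← Finset.sum_sub_distrib]
  refine Finset.sum_congr rfl fun j _ => ?_
  rw [chTensor_eq_mul_rest3 (v j) f, chTensor_eq_mul_rest3 (v j) f, rest3_update, rest3_update]
  simp only [Function.update_self]
  ring

/-- **THE COMPANION LAW (imbalance moments vanish).** If a general design's class tensor passes (A1), then for every factor `f`
and every probe word `x`: `Σ_j c_j · δ_{j,f} · Π_{g≠f} v_{j,g}(x_g) = 0`, `δ_{j,f} := v_{j,f}(u) − v_{j,f}(v)` (`= α − α′` for a block). -/
theorem imbalance_moment_eq_zero (s : Finset ι) (c : ι → R) (v : ι → Fin 4 → Fin 6 → R)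
    (hA : ClassScreen (dTensor s c v)) (f : Fin 4) (x : CWord) :
    ∑ j ∈ s, c j * (v j f 1 - v j f 2) * rest3 (v j) f x = 0 := by
  rw [← dTensor_update_one_sub_two, ← swapAt_update_one, swap_law _ hA, sub_self]

/-- with NORMALISED letters (`v_{j,g}(1) = 1`, as for every block) the probe `x = 1111` has `rest3 = 1`. -/
theorem rest3_const_zero (u : Fin 4 → Fin 6 → R) (hu : ∀ g, u g 0 = 1) (f : Fin 4) :
    rest3 u f (fun _ => 0) = 1 := by
  fin_cases f <;> simp [rest3, chTensor, hu]

/-- **total signed imbalance vanishes**: `Σ_j c_j δ_{j,f} = 0`, i.e. `Σ_N m δ_f = Σ_P m δ_f` on every factor. -/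
theorem total_imbalance_eq_zero (s : Finset ι) (c : ι → R) (v : ι → Fin 4 → Fin 6 → R)
    (hv : ∀ j g, v j g 0 = 1) (hA : ClassScreen (dTensor s c v)) (f : Fin 4) :
    ∑ j ∈ s, c j * (v j f 1 - v j f 2) = 0 := by
  have h := imbalance_moment_eq_zero s c v hA f (fun _ => 0)
  simpa [rest3_const_zero _ (hv _)] using h

/-- **NO LONE UNBALANCED CELL.** If every cell other than `j₀` is balanced on factor `f`, then `c_{j₀} · δ_{j₀,f} = 0`;
so (next lemma) in a domain a cell of non-zero weight cannot be the only cell unbalanced on a factor. -/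
theorem lone_unbalanced_weight_mul_eq_zero [DecidableEq ι] (s : Finset ι) (c : ι → R) (v : ι → Fin 4 → Fin 6 → R)
    (hv : ∀ j g, v j g 0 = 1) (hA : ClassScreen (dTensor s c v)) (f : Fin 4) (j₀ : ι) (hj₀ : j₀ ∈ s)
    (hlone : ∀ j ∈ s, j ≠ j₀ → v j f 1 = v j f 2) :
    c j₀ * (v j₀ f 1 - v j₀ f 2) = 0 := by
  have h := total_imbalance_eq_zero s c v hv hA f
  rwa [Finset.sum_eq_single j₀ (fun j hj hne => by rw [hlone j hj hne, sub_self, mul_zero])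
    (fun h => (h hj₀).elim)] at h

theorem no_lone_unbalanced_cell [IsDomain R] [DecidableEq ι] (s : Finset ι) (c : ι → R) (v : ι → Fin 4 → Fin 6 → R)
    (hv : ∀ j g, v j g 0 = 1) (hA : ClassScreen (dTensor s c v)) (f : Fin 4) (j₀ : ι) (hj₀ : j₀ ∈ s)
    (hc : c j₀ ≠ 0) (hlone : ∀ j ∈ s, j ≠ j₀ → v j f 1 = v j f 2) :
    v j₀ f 1 = v j₀ f 2 := by
  have h := lone_unbalanced_weight_mul_eq_zero s c v hv hA f j₀ hj₀ hlone
  rcases mul_eq_zero.1 h with h | h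
  · exact (hc h).elim
  · exact sub_eq_zero.1 h

/-- a probe with ONE non-trivial letter `l` at `g ≠ f`: `rest3 = v_g(l)` for normalised letters. -/
theorem rest3_single (u : Fin 4 → Fin 6 → R) (hu : ∀ g, u g 0 = 1) {f g : Fin 4} (hgf : g ≠ f) (l : Fin 6) :
    rest3 u f (Function.update (fun _ => (0 : Fin 6)) g l) = u g l := by
  fin_cases f <;> fin_cases g <;> first | exact (hgf rfl).elim | simp [rest3, chTensor, hu]

/-- **COMPANION PAIR.** If exactly two cells `j₁ ≠ j₂` are unbalanced on factor `f`, then (1) their weighted imbalances cancel,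
`c₁δ₁ + c₂δ₂ = 0`, and (2) `c₁δ₁ · (v_{j₁,g}(l) − v_{j₂,g}(l)) = 0` for every other factor `g` and letter slot `l` — in a domain with
`c₁δ₁ ≠ 0` the two cells carry IDENTICAL letters off `f`: an `f`-local twin (same level, opposite `δ`) or an `f`-local partner pair
(opposite levels, equal `mδ`). -/
theorem companion_pair [DecidableEq ι] (s : Finset ι) (c : ι → R) (v : ι → Fin 4 → Fin 6 → R)
    (hv : ∀ j g, v j g 0 = 1) (hA : ClassScreen (dTensor s c v)) (f : Fin 4) (j₁ j₂ : ι) (h12 : j₁ ≠ j₂)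
    (hj₁ : j₁ ∈ s) (hj₂ : j₂ ∈ s) (hpair : ∀ j ∈ s, j ≠ j₁ → j ≠ j₂ → v j f 1 = v j f 2) :
    c j₁ * (v j₁ f 1 - v j₁ f 2) + c j₂ * (v j₂ f 1 - v j₂ f 2) = 0 ∧
      ∀ g, g ≠ f → ∀ l, c j₁ * (v j₁ f 1 - v j₁ f 2) * (v j₁ g l - v j₂ g l) = 0 := by
  -- every moment reduces to its two unbalanced terms
  have two : ∀ x : CWord, c j₁ * (v j₁ f 1 - v j₁ f 2) * rest3 (v j₁) f x
      + c j₂ * (v j₂ f 1 - v j₂ f 2) * rest3 (v j₂) f x = 0 := by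
    intro x
    have h := imbalance_moment_eq_zero s c v hA f x
    rw [← Finset.add_sum_erase s _ hj₁, ← Finset.add_sum_erase _ _ (Finset.mem_erase.2 ⟨h12.symm, hj₂⟩),
      Finset.sum_eq_zero, add_zero] at h
    · exact h
    · intro j hj
      simp only [Finset.mem_erase] at hj
      rw [hpair j hj.2.2 hj.2.1 hj.1, sub_self, mul_zero, zero_mul]
  have h1 : c j₁ * (v j₁ f 1 - v j₁ f 2) + c j₂ * (v j₂ f 1 - v j₂ f 2) = 0 := by
    simpa [rest3_const_zero _ (hv _)] using two (fun _ => 0)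
  refine ⟨h1, fun g hgf l => ?_⟩
  have h2 := two (Function.update (fun _ => (0 : Fin 6)) g l)
  rw [rest3_single _ (hv _) hgf, rest3_single _ (hv _) hgf] at h2
  have e2 : c j₂ * (v j₂ f 1 - v j₂ f 2) = -(c j₁ * (v j₁ f 1 - v j₁ f 2)) := by
    rw [eq_neg_iff_add_eq_zero, add_comm]; exact h1
  rw [e2] at h2
  linear_combination h2

theorem companion_pair_agree_off [IsDomain R] [DecidableEq ι] (s : Finset ι) (c : ι → R) (v : ι → Fin 4 → Fin 6 → R)
    (hv : ∀ j g, v j g 0 = 1) (hA : ClassScreen (dTensor s c v)) (f : Fin 4) (j₁ j₂ : ι) (h12 : j₁ ≠ j₂)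
    (hj₁ : j₁ ∈ s) (hj₂ : j₂ ∈ s) (hpair : ∀ j ∈ s, j ≠ j₁ → j ≠ j₂ → v j f 1 = v j f 2)
    (hne : c j₁ * (v j₁ f 1 - v j₁ f 2) ≠ 0) :
    ∀ g, g ≠ f → v j₁ g = v j₂ g := by
  intro g hgf
  funext l
  have h := (companion_pair s c v hv hA f j₁ j₂ h12 hj₁ hj₂ hpair).2 g hgf l
  rcases mul_eq_zero.1 h with h | h
  · exact (hne h).elim
  · exact sub_eq_zero.1 h

/-- the product of the two letters off the pair of factors `f ≠ g` (both replaced by `1`). -/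
def rest2 (u : Fin 4 → Fin 6 → R) (f g : Fin 4) (x : CWord) : R :=
  chTensor (Function.update (Function.update u f fun _ => 1) g fun _ => 1) x

/-- **MIXED MOMENTS vanish**: `Σ_j c_j δ_{j,f} δ_{j,g} · Π_{h ≠ f,g} v_{j,h}(x_h) = 0` for `f ≠ g`
(alternating sum of the four swap-related words `x[u_f u_g], x[v_f u_g], x[u_f v_g], x[v_f v_g]`). -/
theorem mixed_moment_eq_zero (s : Finset ι) (c : ι → R) (v : ι → Fin 4 → Fin 6 → R)
    (hA : ClassScreen (dTensor s c v)) {f g : Fin 4} (hfg : f ≠ g) (x : CWord) :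
    ∑ j ∈ s, c j * ((v j f 1 - v j f 2) * (v j g 1 - v j g 2)) * rest2 (v j) f g x = 0 := by
  -- the imbalance moment of `f` at the probes `x[g ↦ u]` and `x[g ↦ v]`
  have hu := imbalance_moment_eq_zero s c v hA f (Function.update x g 1)
  have hv' := imbalance_moment_eq_zero s c v hA f (Function.update x g 2)
  have key : ∀ j, rest3 (v j) f (Function.update x g 1) - rest3 (v j) f (Function.update x g 2)
      = (v j g 1 - v j g 2) * rest2 (v j) f g x := by
    intro j
    fin_cases f <;> fin_cases g <;> first | exact (hfg rfl).elim |
      (simp [rest3, rest2, chTensor]; ring)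
  have : ∑ j ∈ s, c j * ((v j f 1 - v j f 2) * (v j g 1 - v j g 2)) * rest2 (v j) f g x
      = ∑ j ∈ s, c j * (v j f 1 - v j f 2) * rest3 (v j) f (Function.update x g 1)
        - ∑ j ∈ s, c j * (v j f 1 - v j f 2) * rest3 (v j) f (Function.update x g 2) := by
    rw [← Finset.sum_sub_distrib]
    refine Finset.sum_congr rfl fun j _ => ?_
    rw [← mul_sub, key j]
    ring
  rw [this, hu, hv', sub_zero]

end Companion

/-! ## §3 Ψ-rows on general blocks: u-reading, v-reading, and the PHANTOM-CHARGE (symmetric) reading -/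

section PsiRows

variable {R : Type*} [CommRing R] {ι : Type*}

/-- the letter vector of a GENERAL block `[[α, β], [β̄, α′]]`: `(1, α, α′, β, β̄, αα′ − ββ̄)` (pad4lib `phi(blk(α, α′, β))`). -/
def gphi (α α' β βc : R) : Fin 6 → R := ![1, α, α', β, βc, α * α' - β * βc]

/-- the balanced letter is the diagonal case. -/
theorem gphi_diag (α β βc : R) : gphi α α β βc = phiVec α β βc (α ^ 2 - β * βc) := by
  funext l
  fin_cases l <;> simp [gphi, phiVec]
  ring

/-- **SEAM with the tree's balanced cells**: `bphi x` (`Pad4TowerPsiSubA1`, the letter of a 𝔅(μ₄) point `x = (α, Re β, Im β)`) is the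
DIAGONAL general letter `gphi α α β β̄` over `ℤ[i]` — so `MConfig.wch` is a `dTensor` of balanced letters and §2 is vacuous there. -/
theorem bphi_eq_gphi (x : BPoint) :
    bphi x = gphi (x.1 : GaussianInt) (x.1 : GaussianInt) ⟨x.2.1, x.2.2⟩ ⟨x.2.1, -x.2.2⟩ := by
  funext l
  fin_cases l <;>
    simp [bphi, gphi, phiVec, Zsqrtd.ext_iff, sq, Zsqrtd.re_intCast, Zsqrtd.im_intCast, Zsqrtd.re_mul, Zsqrtd.im_mul]
  constructor <;> ring

/-- **u-reading of Λ**: `Λ₁₂(⊗_f gphi_f) = 12Ψ(α; s^u)`, `s^u_f = β_f β̄_f + α_f (α_f − α′_f)` (Λ reads only the letters `1, u, p`). [`ring`] -/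
theorem lamTwelve_chTensor_gphi (α α' β βc : Fin 4 → R) :
    lamTwelve (chTensor fun f => gphi (α f) (α' f) (β f) (βc f))
      = psiTwelve α (fun f => β f * βc f + α f * (α f - α' f)) := by
  simp only [lamTwelve_apply, chTensor, gphi, psiTwelve]
  simp only [Matrix.cons_val_zero, Matrix.cons_val_one, Matrix.cons_val]
  ring

/-- the design tensor as a linear combination of cell tensors (function level). -/
theorem dTensor_eq_sum (s : Finset ι) (c : ι → R) (v : ι → Fin 4 → Fin 6 → R) :
    dTensor s c v = ∑ j ∈ s, c j • chTensor (v j) := by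
  funext w
  simp [dTensor, Finset.sum_apply, smul_eq_mul]

theorem lamTwelve_dTensor (s : Finset ι) (c : ι → R) (v : ι → Fin 4 → Fin 6 → R) :
    lamTwelve (dTensor s c v) = ∑ j ∈ s, c j * lamTwelve (chTensor (v j)) := by
  rw [dTensor_eq_sum, map_sum]
  simp only [map_smul, smul_eq_mul]

/-- **THE u-Ψ-ROW on general blocks**: (A1) ⇒ `Σ_j c_j · 12Ψ(α_j; |β|² + αδ) = 0`. -/
theorem psiRow_u_of_classScreen (s : Finset ι) (c : ι → R) (α α' β βc : ι → Fin 4 → R)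
    (hA : ClassScreen (dTensor s c fun j f => gphi (α j f) (α' j f) (β j f) (βc j f))) :
    ∑ j ∈ s, c j * psiTwelve (α j) (fun f => β j f * βc j f + α j f * (α j f - α' j f)) = 0 := by
  have h := lamTwelve_eq_zero_of_classScreen _ hA
  rw [lamTwelve_dTensor] at h
  simpa only [lamTwelve_chTensor_gphi] using h

/-- general letters are NORMALISED (`1`-entry `= 1`). -/
theorem gphi_zero (α α' β βc : R) : gphi α α' β βc 0 = 1 := by simp [gphi]

/-- the imbalance of a general letter: `gphi(u) − gphi(v) = α − α′ =: δ`. -/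
theorem gphi_one_sub_two (α α' β βc : R) : gphi α α' β βc 1 - gphi α α' β βc 2 = α - α' := by simp [gphi]

/-- **block form of the total imbalance law**: (A1) ⇒ `Σ_j c_j (α_{j,f} − α′_{j,f}) = 0` on every factor. -/
theorem total_delta_eq_zero (s : Finset ι) (c : ι → R) (α α' β βc : ι → Fin 4 → R)
    (hA : ClassScreen (dTensor s c fun j f => gphi (α j f) (α' j f) (β j f) (βc j f))) (f : Fin 4) :
    ∑ j ∈ s, c j * (α j f - α' j f) = 0 := by
  have h := total_imbalance_eq_zero s c _ (fun j g => gphi_zero _ _ _ _) hA f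
  simpa only [gphi_one_sub_two] using h

/-- **block form of the CHARGED imbalance law** (probe `eee`, factor `0`; cyclically for the others):
(A1) ⇒ `Σ_j c_j (α_{j,0} − α′_{j,0}) · β_{j,1} β_{j,2} β_{j,3} = 0` — a weight-4 row with three `e`'s, seen by NO e-free functional. -/
theorem charged_delta_eq_zero_factor0 (s : Finset ι) (c : ι → R) (α α' β βc : ι → Fin 4 → R)
    (hA : ClassScreen (dTensor s c fun j f => gphi (α j f) (α' j f) (β j f) (βc j f))) :
    ∑ j ∈ s, c j * (α j 0 - α' j 0) * (β j 1 * β j 2 * β j 3) = 0 := by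
  have h := imbalance_moment_eq_zero s c _ hA 0 (fun _ => 3)
  simpa [rest3, chTensor, gphi] using h

/-- swapping every factor of every cell's letter vector: the v-reading design. -/
theorem dTensor_swapAll (s : Finset ι) (c : ι → R) (v : ι → Fin 4 → Fin 6 → R) (w : CWord) :
    dTensor s c (fun j f l => v j f (lswap l)) w
      = dTensor s c v (swapAt 0 (swapAt 1 (swapAt 2 (swapAt 3 w)))) := by
  simp [dTensor, chTensor, swapAt]

/-- (A1) passes to the fully swapped design (the class function is the same up to the swap law). -/
theorem classScreen_swapAll (s : Finset ι) (c : ι → R) (v : ι → Fin 4 → Fin 6 → R)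
    (hA : ClassScreen (dTensor s c v)) : ClassScreen (dTensor s c fun j f l => v j f (lswap l)) := by
  have e : dTensor s c (fun j f l => v j f (lswap l)) = dTensor s c v := by
    funext w
    rw [dTensor_swapAll, swap_law _ hA, swap_law _ hA, swap_law _ hA, swap_law _ hA]
  rw [e]; exact hA

/-- the swapped general letter is the general letter with `α ↔ α′`. -/
theorem gphi_lswap (α α' β βc : R) : (fun l => gphi α α' β βc (lswap l)) = gphi α' α β βc := by
  funext l
  fin_cases l <;> simp [gphi, lswap]
  ring

/-- **THE v-Ψ-ROW on general blocks**: (A1) ⇒ `Σ_j c_j · 12Ψ(α′_j; |β|² − α′δ) = 0`. -/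
theorem psiRow_v_of_classScreen (s : Finset ι) (c : ι → R) (α α' β βc : ι → Fin 4 → R)
    (hA : ClassScreen (dTensor s c fun j f => gphi (α j f) (α' j f) (β j f) (βc j f))) :
    ∑ j ∈ s, c j * psiTwelve (α' j) (fun f => β j f * βc j f + α' j f * (α' j f - α j f)) = 0 := by
  have h := classScreen_swapAll s c _ hA
  have e : (fun j f l => gphi (α j f) (α' j f) (β j f) (βc j f) (lswap l))
      = fun j f => gphi (α' j f) (α j f) (β j f) (βc j f) := by
    funext j f
    exact gphi_lswap _ _ _ _
  rw [e] at h
  exact psiRow_u_of_classScreen s c α' α β βc h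

end PsiRows

section Phantom

variable {K : Type*} [Field K] [NeZero (2 : K)] {ι : Type*}

/-- symmetrise the `f`-th letter vector of every cell: `l ↦ (v(l) + v(lswap l))∕2`. -/
def symAt (f : Fin 4) (v : ι → Fin 4 → Fin 6 → K) : ι → Fin 4 → Fin 6 → K :=
  fun j => Function.update (v j) f fun l => (v j f l + v j f (lswap l)) / 2

/-- one symmetrisation step averages the class function with its swap. -/
theorem dTensor_symAt (s : Finset ι) (c : ι → K) (v : ι → Fin 4 → Fin 6 → K) (f : Fin 4) (w : CWord) :
    dTensor s c (symAt f v) w = (dTensor s c v w + dTensor s c v (swapAt f w)) / 2 := by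
  have two : (2 : K) ≠ 0 := NeZero.ne 2
  have h2 : (2 : K)⁻¹ * 2 = 1 := inv_mul_cancel₀ two
  rw [eq_div_iff two]
  simp only [dTensor, symAt, Finset.sum_mul, ← Finset.sum_add_distrib]
  refine Finset.sum_congr rfl fun j _ => ?_
  have hr : rest3 (v j) f (swapAt f w) = rest3 (v j) f w := by
    fin_cases f <;> simp [rest3, chTensor, swapAt]
  rw [chTensor_update, chTensor_eq_mul_rest3 (v j) f w, chTensor_eq_mul_rest3 (v j) f (swapAt f w), swapAt_same, hr]
  linear_combination (c j * (v j f (w f) + v j f (lswap (w f))) * rest3 (v j) f w) * h2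

/-- under (A1) a symmetrisation step does not change the class function. -/
theorem dTensor_symAt_eq (s : Finset ι) (c : ι → K) (v : ι → Fin 4 → Fin 6 → K) (hA : ClassScreen (dTensor s c v))
    (f : Fin 4) : dTensor s c (symAt f v) = dTensor s c v := by
  funext w
  rw [dTensor_symAt, swap_law _ hA, ← two_mul, mul_div_cancel_left₀ _ (NeZero.ne 2)]

/-- symmetrise all four factors. -/
def symAll (v : ι → Fin 4 → Fin 6 → K) : ι → Fin 4 → Fin 6 → K := symAt 3 (symAt 2 (symAt 1 (symAt 0 v)))

/-- **under (A1) the design tensor EQUALS the tensor of its factorwise-symmetrised letters.** -/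
theorem dTensor_symAll_eq (s : Finset ι) (c : ι → K) (v : ι → Fin 4 → Fin 6 → K) (hA : ClassScreen (dTensor s c v)) :
    dTensor s c (symAll v) = dTensor s c v := by
  have h0 := dTensor_symAt_eq s c v hA 0
  have h1 := dTensor_symAt_eq s c (symAt 0 v) (h0 ▸ hA) 1
  have h2 := dTensor_symAt_eq s c (symAt 1 (symAt 0 v)) ((h1.trans h0) ▸ hA) 2
  have h3 := dTensor_symAt_eq s c (symAt 2 (symAt 1 (symAt 0 v))) ((h2.trans (h1.trans h0)) ▸ hA) 3
  exact h3.trans (h2.trans (h1.trans h0))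

/-- the symmetrised general letter is the tree's BALANCED letter vector `phiVec α̃ β β̄ p`, `α̃ = (α + α′)∕2`, with the SAME `p = αα′ − ββ̄`
— OFF SHELL by the phantom charge: `α̃² − p = ββ̄ + ((α − α′)∕2)²`. -/
theorem symAll_gphi (α α' β βc : ι → Fin 4 → K) :
    symAll (fun j f => gphi (α j f) (α' j f) (β j f) (βc j f))
      = fun j f => phiVec ((α j f + α' j f) / 2) (β j f) (βc j f) (α j f * α' j f - β j f * βc j f) := by
  have two : (2 : K) ≠ 0 := NeZero.ne 2
  funext j f l
  fin_cases f <;> fin_cases l <;>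
    (simp [symAll, symAt, gphi, phiVec, lswap]; try field_simp; try ring)

/-- **THE PHANTOM-CHARGE Ψ-ROW**: (A1) ⇒ `Σ_j c_j · 12Ψ(α̃_j; s̃_j) = 0` with `α̃ = (α + α′)∕2` and `s̃_f = β_f β̄_f + ((α_f − α′_f)∕2)²`:
the Ψ-row of an unbalanced design is the BALANCED Ψ-row with the phantom charge `δ²∕4` added to `|β|²`. -/
theorem psiRow_phantom_of_classScreen (s : Finset ι) (c : ι → K) (α α' β βc : ι → Fin 4 → K)
    (hA : ClassScreen (dTensor s c fun j f => gphi (α j f) (α' j f) (β j f) (βc j f))) :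
    ∑ j ∈ s, c j * psiTwelve (fun f => (α j f + α' j f) / 2)
        (fun f => β j f * βc j f + ((α j f - α' j f) / 2) ^ 2) = 0 := by
  have two : (2 : K) ≠ 0 := NeZero.ne 2
  have hS := dTensor_symAll_eq s c _ hA
  have hA' : ClassScreen (dTensor s c (symAll fun j f => gphi (α j f) (α' j f) (β j f) (βc j f))) := by rw [hS]; exact hA
  have h := lamTwelve_eq_zero_of_classScreen _ hA'
  rw [symAll_gphi, lamTwelve_dTensor] at h
  simp only [lamTwelve_chTensor_phiVec] at h
  rw [← h]
  refine Finset.sum_congr rfl fun j _ => ?_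
  congr 1
  congr 1
  funext f
  field_simp
  ring

end Phantom

/-! ## §4 CLASS-LEVEL INERTNESS of imbalance (constructive exchange identities) -/

section Inertness

variable {R : Type*} [CommRing R]

/-- the ON-SHELL balanced letter `(1, a, a, β, β̄, a² − ββ̄)`. -/
def phiOn (a β βc : R) : Fin 6 → R := phiVec a β βc (a ^ 2 - β * βc)

/-- **u-reading**: off the letter `v`, an unbalanced letter IS the tree's balanced letter vector with its `p`-entry off shell by `−αδ`:
`gphi α α′ β β̄ (l) = phiVec α β β̄ (αα′ − ββ̄) (l)` for `l ≠ v`. -/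
theorem gphi_eq_phiVec_off_v (α α' β βc : R) (l : Fin 6) (hl : l ≠ 2) :
    gphi α α' β βc l = phiVec α β βc (α * α' - β * βc) l := by
  fin_cases l <;> first | exact (hl rfl).elim | simp [gphi, phiVec]

/-- **u-READING EXCHANGE**: off the letter `v`, TWICE an unbalanced letter is an INTEGER combination of three balanced tower letters
`(α−1, β), (α, β), (α+1, β)`: `2·gphi(α, α′, β) ≐ (2 + 2αδ)·φ(α) − αδ·φ(α+1) − αδ·φ(α−1)`, `δ = α − α′` — so on v-free words every
general design reads as a balanced design (class-level inertness of imbalance, constructive; combine with `T_toU` of §5 and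
`chTensor_update_linear`). -/
theorem two_mul_gphi_u_exchange (α α' β βc : R) (l : Fin 6) (hl : l ≠ 2) :
    2 * gphi α α' β βc l
      = (2 + 2 * (α * (α - α'))) * phiOn α β βc l - α * (α - α') * phiOn (α + 1) β βc l
          - α * (α - α') * phiOn (α - 1) β βc l := by
  fin_cases l <;> first | exact (hl rfl).elim | (simp [gphi, phiOn, phiVec]; ring)

/-- **u-READING EXCHANGE, FORWARD STEP-2 FORM** (stays inside the census universes: same `β`, node level `α − c` shifted by `2, 4` —
same parity — forward light cone preserved, causal height `+4` at most; `◇_h ↦ ◇_{h+4}`): off the letter `v`,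
`8·gphi(α, α′, β) ≐ (8 − αδ)·φ(α) + 2αδ·φ(α+2) − αδ·φ(α+4)`, `δ = α − α′`. -/
theorem eight_mul_gphi_u_exchange_fwd (α α' β βc : R) (l : Fin 6) (hl : l ≠ 2) :
    8 * gphi α α' β βc l
      = (8 - α * (α - α')) * phiOn α β βc l + 2 * (α * (α - α')) * phiOn (α + 2) β βc l
          - α * (α - α') * phiOn (α + 4) β βc l := by
  fin_cases l <;> first | exact (hl rfl).elim | (simp [gphi, phiOn, phiVec]; ring)

/-- **tower second difference**: three on-shell balanced letters stacked in `α` (`x − I, x, x + I`, same `β`) have second difference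
`2·e_p` — pure `p`-shifts are CLASSES OF BALANCED TOWERS. -/
theorem tower_second_difference (a β βc : R) :
    phiOn (a + 1) β βc - 2 • phiOn a β βc + phiOn (a - 1) β βc = fun l => if l = 5 then 2 else 0 := by
  funext l
  fin_cases l <;> simp [phiOn, phiVec] <;> ring

/-- **TWIN-PAIR EXCHANGE.** The unbalanced twin pair `{(a+d, a−d, β), (a−d, a+d, β)}` on a factor is, as a class, two balanced
on-shell letters `(a, β)` minus `d²` times a balanced tower second difference with ANY base `(y, β′)`. -/
theorem twin_pair_exchange (a d β βc y β' βc' : R) :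
    gphi (a + d) (a - d) β βc + gphi (a - d) (a + d) β βc
      = 2 • phiOn a β βc - d ^ 2 • (phiOn (y + 1) β' βc' - 2 • phiOn y β' βc' + phiOn (y - 1) β' βc') := by
  rw [tower_second_difference]
  funext l
  fin_cases l <;> simp [gphi, phiOn, phiVec] <;> ring

/-- the same at CELL level on factor `f` (all other letters of the cell `u` fixed): twin cells are a balanced combination. -/
theorem twin_cells_exchange (u : Fin 4 → Fin 6 → R) (f : Fin 4) (a d β βc y β' βc' : R) (x : CWord) :
    chTensor (Function.update u f (gphi (a + d) (a - d) β βc)) x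
      + chTensor (Function.update u f (gphi (a - d) (a + d) β βc)) x
      = 2 * chTensor (Function.update u f (phiOn a β βc)) x
        - d ^ 2 * (chTensor (Function.update u f (phiOn (y + 1) β' βc')) x
            - 2 * chTensor (Function.update u f (phiOn y β' βc')) x
            + chTensor (Function.update u f (phiOn (y - 1) β' βc')) x) := by
  simp only [chTensor_update]
  have h := congrFun (twin_pair_exchange a d β βc y β' βc') (x f)
  simp only [Pi.add_apply, Pi.sub_apply, Pi.smul_apply, smul_eq_mul] at h
  rw [← add_mul, h]
  ring

end Inertness

/-! ## §5 (A1) on general blocks = the u-screen + the swap rows (the encodable form of an (F3) cell) -/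

section UScreen

variable {R : Type*}

/-- a v-FREE word (no letter `v`): the words of the balanced frame's u-reading. -/
abbrev VFree (w : CWord) : Prop := ∀ f, w f ≠ 2

/-- the class screen restricted to v-free words. -/
def ClassScreenU [Zero R] (T : CWord → R) : Prop :=
  (∀ w, VFree w → ¬ EFree w → w ≠ eWord → w ≠ ebarWord → T w = 0) ∧
    (∀ w w', VFree w → VFree w' → EFree w → EFree w' → wdeg w = wdeg w' → T w = T w')

/-- swap-invariance on every factor. -/
def SwapInvariant (T : CWord → R) : Prop := ∀ f w, T (swapAt f w) = T w

/-- replace every `v` by `u`. -/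
def toU (w : CWord) : CWord := fun g => if w g = 2 then 1 else w g

theorem vFree_toU (w : CWord) : VFree (toU w) := by
  intro g; by_cases h : w g = 2 <;> simp [toU, h]

theorem eFree_toU_iff (w : CWord) : EFree (toU w) ↔ EFree w := by
  refine forall_congr' fun g => ?_
  by_cases h : w g = 2 <;> simp [toU, h]

theorem wdeg_toU (w : CWord) : wdeg (toU w) = wdeg w := by
  have hl : ∀ l : Fin 6, ldeg (if l = 2 then 1 else l) = ldeg l := by decide
  simp only [wdeg, toU, hl]

theorem toU_eq_eWord_iff (w : CWord) : toU w = eWord ↔ w = eWord := by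
  have e3 : ∀ g : Fin 4, eWord g = 3 := by decide
  have hl : ∀ l : Fin 6, (if l = 2 then (1 : Fin 6) else l) = 3 ↔ l = 3 := by decide
  simp only [funext_iff, e3, toU, hl]

theorem toU_eq_ebarWord_iff (w : CWord) : toU w = ebarWord ↔ w = ebarWord := by
  have e4 : ∀ g : Fin 4, ebarWord g = 4 := by decide
  have hl : ∀ l : Fin 6, (if l = 2 then (1 : Fin 6) else l) = 4 ↔ l = 4 := by decide
  simp only [funext_iff, e4, toU, hl]

/-- conditional swap at `g`: swap factor `g` iff its letter is `v`. -/
def fixAt (g : Fin 4) (w : CWord) : CWord := if w g = 2 then swapAt g w else w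

theorem T_fixAt (T : CWord → R) (hT : SwapInvariant T) (g : Fin 4) (w : CWord) : T (fixAt g w) = T w := by
  unfold fixAt; split_ifs
  · exact hT g w
  · rfl

theorem fixAt_apply (k : Fin 4) (w : CWord) (g : Fin 4) :
    fixAt k w g = if g = k then (if w g = 2 then 1 else w g) else w g := by
  unfold fixAt
  by_cases hg : g = k
  · subst hg
    by_cases h2 : w g = 2
    · simp [h2, swapAt, lswap]
    · simp [h2]
  · by_cases h2 : w k = 2
    · simp [h2, hg, swapAt]
    · simp [h2, hg]

theorem toU_eq_fix (w : CWord) : toU w = fixAt 0 (fixAt 1 (fixAt 2 (fixAt 3 w))) := by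
  funext g
  fin_cases g <;> simp [toU, fixAt_apply]

/-- a swap-invariant class function is determined by its u-reading. -/
theorem T_toU (T : CWord → R) (hT : SwapInvariant T) (w : CWord) : T (toU w) = T w := by
  rw [toU_eq_fix, T_fixAt T hT, T_fixAt T hT, T_fixAt T hT, T_fixAt T hT]

/-- **(A1) ⟺ swap rows ∧ u-screen.** -/
theorem classScreen_iff_swap_and_uScreen [Zero R] (T : CWord → R) :
    ClassScreen T ↔ SwapInvariant T ∧ ClassScreenU T := by
  constructor
  · intro hT
    refine ⟨fun f w => swap_law T hT f w, fun w _ => hT.1 w, fun w w' _ _ => hT.2 w w'⟩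
  · rintro ⟨hS, h0, hd⟩
    refine ⟨fun w hw he hb => ?_, fun w w' hw hw' hdeg => ?_⟩
    · rw [← T_toU T hS w]
      exact h0 _ (vFree_toU w) (fun h => hw ((eFree_toU_iff w).1 h)) (fun h => he ((toU_eq_eWord_iff w).1 h))
        (fun h => hb ((toU_eq_ebarWord_iff w).1 h))
    · rw [← T_toU T hS w, ← T_toU T hS w']
      exact hd _ _ (vFree_toU w) (vFree_toU w') ((eFree_toU_iff w).2 hw) ((eFree_toU_iff w').2 hw')
        (by rw [wdeg_toU, wdeg_toU, hdeg])

end UScreen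


/-! ## §7 E-frame transfer (rev 2 — the support-level half of U4-3, branch-neutral)

An E-FRAME word has every letter in `{1, e, ē}` = `{0, 3, 4}` (no `u`, `v`, `p` letter): the fourteen FC-CORE rows are the rows of
the sign words `sWord s` (`Pad4TowerFCCoreSeam`; letters `e`, `ē` only), and `μ = T(eeee)`, `μ̄ = T(ēēēē)` are E-frame too. An E-frame
row reads only the entries `0, 3, 4` of the letter vectors, on which a general ⊕-block letter `gphi α α′ β β̄` AGREES with its u-reading
`gphi α α β β̄` and its v-reading `gphi α′ α′ β β̄`. Hence every E-frame row of an (F3) design — in particular the (A1)(i) input of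
FC-CORE (`T (sWord s) = 0`, `s ≠ 0, 15`) and `μ`, `μ̄` — COINCIDES with the same row of both balanced readings: it transfers with NO
exchange and NO height shift (contrast §4, where the full class function is exchanged into the balanced tower with shift `◇_h ↦ ◇_{h+4}`).
Caveat, typed below by omission: the u-reading design need NOT pass (A1) itself (its `u`∕`p` rows differ from the (F3) design's). -/

section EFrame

variable {R : Type*} [CommRing R] {ι : Type*}

/-- an E-FRAME word: every letter is `1`, `e` or `ē`. -/
def EFrameWord (w : CWord) : Prop := ∀ f, w f = 0 ∨ w f = 3 ∨ w f = 4

theorem eFrameWord_eWord : EFrameWord eWord := by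
  intro f; fin_cases f <;> simp [eWord]

theorem eFrameWord_ebarWord : EFrameWord ebarWord := by
  intro f; fin_cases f <;> simp [ebarWord]

/-- the sixteen sign words of FC-CORE are E-frame words. -/
theorem eFrameWord_sWord (s : Fin 16) : EFrameWord (sWord s) := by
  intro f
  by_cases h : bitOf s f = 0
  · right; right; simp [sWord, h]
  · right; left; simp [sWord, h]

/-- an E-frame word is never e-free unless it is `1111`; recorded for orientation: the E-frame rows other than `T 1111` are (A1)(i) rows
or the two pure rows. -/
theorem eFrameWord_const_one : EFrameWord (fun _ => 0) := fun _ => Or.inl rfl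

/-- two letter assignments that agree on the entries `0, 3, 4` have the same E-frame cell rows. -/
theorem chTensor_congr_eFrame (u u' : Fin 4 → Fin 6 → R)
    (h : ∀ f, u f 0 = u' f 0 ∧ u f 3 = u' f 3 ∧ u f 4 = u' f 4) (w : CWord) (hw : EFrameWord w) :
    chTensor u w = chTensor u' w := by
  have key : ∀ f, u f (w f) = u' f (w f) := fun f => by
    rcases hw f with h0 | h3 | h4
    · rw [h0]; exact (h f).1
    · rw [h3]; exact (h f).2.1
    · rw [h4]; exact (h f).2.2
  simp only [chTensor, key]

/-- two designs that agree cellwise on the entries `0, 3, 4` have the same E-frame rows. -/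
theorem dTensor_congr_eFrame (s : Finset ι) (c : ι → R) (v v' : ι → Fin 4 → Fin 6 → R)
    (h : ∀ j ∈ s, ∀ f, v j f 0 = v' j f 0 ∧ v j f 3 = v' j f 3 ∧ v j f 4 = v' j f 4) (w : CWord) (hw : EFrameWord w) :
    dTensor s c v w = dTensor s c v' w := by
  unfold dTensor
  exact Finset.sum_congr rfl fun j hj => by rw [chTensor_congr_eFrame _ _ (h j hj) w hw]

/-- a general ⊕-block letter agrees with its u-reading and with its v-reading on the entries `0, 3, 4`. [`simp`] -/
theorem gphi_readings_agree (α α' β βc : R) :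
    (gphi α α' β βc 0 = gphi α α β βc 0 ∧ gphi α α' β βc 3 = gphi α α β βc 3 ∧ gphi α α' β βc 4 = gphi α α β βc 4) ∧
      (gphi α α' β βc 0 = gphi α' α' β βc 0 ∧ gphi α α' β βc 3 = gphi α' α' β βc 3 ∧
        gphi α α' β βc 4 = gphi α' α' β βc 4) := by
  simp [gphi]

/-- **E-FRAME TRANSFER (u-reading).** Every E-frame row of a general ⊕-block design equals the same row of its u-READING design
(every block replaced by the balanced block `(α_f, β_f)` on shell) — no exchange, no height shift. -/
theorem eFrame_row_eq_uReading (s : Finset ι) (c : ι → R) (α α' β βc : ι → Fin 4 → R) (w : CWord) (hw : EFrameWord w) :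
    dTensor s c (fun j f => gphi (α j f) (α' j f) (β j f) (βc j f)) w =
      dTensor s c (fun j f => gphi (α j f) (α j f) (β j f) (βc j f)) w :=
  dTensor_congr_eFrame s c _ _ (fun j _ f => (gphi_readings_agree (α j f) (α' j f) (β j f) (βc j f)).1) w hw

/-- **E-FRAME TRANSFER (v-reading).** -/
theorem eFrame_row_eq_vReading (s : Finset ι) (c : ι → R) (α α' β βc : ι → Fin 4 → R) (w : CWord) (hw : EFrameWord w) :
    dTensor s c (fun j f => gphi (α j f) (α' j f) (β j f) (βc j f)) w =
      dTensor s c (fun j f => gphi (α' j f) (α' j f) (β j f) (βc j f)) w :=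
  dTensor_congr_eFrame s c _ _ (fun j _ f => (gphi_readings_agree (α j f) (α' j f) (β j f) (βc j f)).2) w hw

/-- the pure coefficients transfer: `μ` (and likewise `μ̄`) of an (F3) design is the `μ` of its u-reading design. -/
theorem mu_eq_uReading (s : Finset ι) (c : ι → R) (α α' β βc : ι → Fin 4 → R) :
    dTensor s c (fun j f => gphi (α j f) (α' j f) (β j f) (βc j f)) eWord =
        dTensor s c (fun j f => gphi (α j f) (α j f) (β j f) (βc j f)) eWord ∧
      dTensor s c (fun j f => gphi (α j f) (α' j f) (β j f) (βc j f)) ebarWord =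
        dTensor s c (fun j f => gphi (α j f) (α j f) (β j f) (βc j f)) ebarWord :=
  ⟨eFrame_row_eq_uReading s c α α' β βc eWord eFrameWord_eWord,
    eFrame_row_eq_uReading s c α α' β βc ebarWord eFrameWord_ebarWord⟩

/-- **FC-CORE'S INPUT TRANSFERS.** If a general ⊕-block design passes (A1), the fourteen mixed sign-word rows of its u-READING design
vanish — exactly the hypothesis FC-CORE consumes (`Pad4TowerFCCoreParitySeam.rows_of_classScreen_axis` uses (A1) only through
`T (sWord s) = 0`, `s ≠ 0, 15`), although the u-reading design itself need not pass (A1). -/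
theorem uReading_sWord_rows_vanish (s : Finset ι) (c : ι → R) (α α' β βc : ι → Fin 4 → R)
    (hA : ClassScreen (dTensor s c fun j f => gphi (α j f) (α' j f) (β j f) (βc j f))) (σ : Fin 16) (hσ : σ ≠ 0 ∧ σ ≠ 15) :
    dTensor s c (fun j f => gphi (α j f) (α j f) (β j f) (βc j f)) (sWord σ) = 0 := by
  obtain ⟨hnf, -, -, hne⟩ := sWord_spec
  rw [← eFrame_row_eq_uReading s c α α' β βc (sWord σ) (eFrameWord_sWord σ)]
  exact hA.1 (sWord σ) (hnf σ) (hne σ hσ.1 hσ.2).1 (hne σ hσ.1 hσ.2).2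

/-- the same for the v-reading. -/
theorem vReading_sWord_rows_vanish (s : Finset ι) (c : ι → R) (α α' β βc : ι → Fin 4 → R)
    (hA : ClassScreen (dTensor s c fun j f => gphi (α j f) (α' j f) (β j f) (βc j f))) (σ : Fin 16) (hσ : σ ≠ 0 ∧ σ ≠ 15) :
    dTensor s c (fun j f => gphi (α' j f) (α' j f) (β j f) (βc j f)) (sWord σ) = 0 := by
  obtain ⟨hnf, -, -, hne⟩ := sWord_spec
  rw [← eFrame_row_eq_vReading s c α α' β βc (sWord σ) (eFrameWord_sWord σ)]
  exact hA.1 (sWord σ) (hnf σ) (hne σ hσ.1 hσ.2).1 (hne σ hσ.1 hσ.2).2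

end EFrame

/-! ## §6 Numeric certificates -/

/-- the twin pair `{(3,1,β), (1,3,β)}` with `β = 1 + i` (`ββ̄ = 2`): class `= 2·(2, β)` on shell minus `1²·`(tower second difference),
read on the `p`-letter: `2·(3·1 − 2) = 2 = 2·(2² − 2) − 1·2`. [`decide` over `ℤ`] -/
example : (2 * (3 * 1 - 2) : ℤ) = 2 * (2 ^ 2 - 2) - 1 ^ 2 * 2 := by decide

/-- a concrete instance of the u-reading: `Λ₁₂` of the single unbalanced cell `(α, α′, β) = (3, 1, 1+i)` on every factor equals
`12Ψ(α = 3; s^u = 2 + 3·2 = 8)` — evaluated: both sides are `3·(8+8−0)² = 768`. [`norm_num`] -/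
example : psiTwelve (R := ℤ) (fun _ => 3) (fun _ => 2 + 3 * (3 - 1)) = 768 := by
  norm_num [psiTwelve]

end Summit.HodgeConjecture.HodgeConjecture.Cruxes.BlochSeedDiscOne.UvSwapCompanionLaw
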